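import Summits.SmoothPoincare4.SmoothPoincare4.Theses.ZeroSurgeryExotic
import Literature.Uncategorized.Crux
import Literature.Topology.FourManifolds.DehnSurgery
import Literature.Topology.FourManifolds.CircleSurgery
import Literature.Topology.FourManifolds.SliceRibbon
import Literature.Topology.FourManifolds.LeeRasmussen
import Literature.Topology.FourManifolds.KnotGroup
import Literature.Topology.FourManifolds.KnotsProofs
import Literature.Topology.FourManifolds.KnotsIsotopyProofs
import HarnessLib

/-!
# Line `lz-transport-theta-window` — checked skeleton for crux `ZeroSurgeryExotic.ZseCruxRasmussen`
(item stmt-SmoothPoincare4-0366, route `route-SmoothPoincare4-ZeroSurgeryExotic`, crux rank 2; idea card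
`Cruxes/ZseCruxRasmussen/Ideas/lz-transport-theta-window.md` — triage r1-1/r1-2/r1-3: pass ×3, ranked first by
triager 3, never planned before this file; strategist seat planner-cstrat-stmt-SmoothPoincare4-0366-p1-0, 2026-08-17).

CRUX (fixed, never restated; the route decl is a TODO comment in `Theses/ZeroSurgeryExotic.lean`, the gate keeps the
ledger signature verbatim as `Literature.Uncategorized.Crux`, which this file concludes BY NAME):
`∃ K K' Y s, IsIntegralSurgery (𝓡 3) Y K 0 ∧ IsIntegralSurgery (𝓡 3) Y K' 0 ∧ K.IsSmoothlySlice ∧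
K'.HasRasmussenInvariant s ∧ s ≠ 0`.

## The line (Lewark–Zibrowius transport into Nakamura's window)

Every 0-surgery homeomorphism presented by a SMALL special RBG link `L = (R, r) ∪ B ∪ G` comes with an AXIS: the
meridian circle `η = μ_R` of the red component, an unknot in `S³ ∖ K_B` and in `S³ ∖ K_G` of winding number `0`
and wrapping number `2` about BOTH knots (the two antiparallel push-offs of `R` are the only strands through its
disc — Manolescu–Piccirillo 2023 §4.2/§5.1, Nakamura 2023 §3.3, p. 13), and the common surgery
`Y = S³_{r,0,0}(L)` sees ONE framed curve `μ_R`: the two surgery pictures of `Y` carry the axis to the same framed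
tube (`AxisFriends`). Two operations act on such an axis pair: (a) `t` full twists through the disc of `η`
(= the framing change `r ↦ r + t`, MP's parameter `a ↦ a + t`), (b) tying a companion `J` into `R`, i.e. the
winding-0 wrapping-2 SATELLITE with companion `J` and pattern `(K, η)`; both are `IsTwistedAxisSatellite K η J t`
(companion `unknot` = pure twisting). Surgery and splicing commute on disjoint supports, so the satellites of an
axis pair are again 0-friends (`stub_axisFriends_satellite`, a 3-manifold lemma). Lewark–Zibrowius (Crelle 2024,
arXiv:2208.13612, Main Theorem p. 2, Def. 1.3, Conj. 1.13): `s_c(P(J)) = s_c(P_{-θ_c(J)}(U))` for every winding-0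
wrapping-2 pattern — a THEOREM for `c = 2`, conjectured for `c = 0` (the tree's `HasRasmussenInvariant` is `s_0`);
`θ_2(T(2,3)) = 4`, `θ_0(T(2,3)) = 3` (LZ eq. (theta_for_trefoil), p. 5). Hence for the companion `J₀ = −T(2,3)`
the `s_0`-value of the satellite is READ OFF the 3-fold twisted pattern at companion `U` (`stub_transportQ`),
where Manolescu–Piccirillo already computed it.

THE INSTANCE (the bet, `stub_windowWitness`). MP's 6-parameter family `L(a,b,c,d,e,f)` (arXiv:2102.04391 §5.1,
Fig. 13; `r = a + b`, box `a` = the 2-strand box of `R` and its framing curve = the axis twist). Seed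
`p* = (0,1,0,−1,2,1)` — the 24th "interesting" pair of MP §5.3 (`s(K_G(p*)) = 0`, `s(K_B(p*)) = −2`), excluded there
only because `K_G(p*)` itself is not H-slice; and MP p. 13 ALSO computed `s(K_B(−1,1,0,−1,2,1)) = −2`. Take the pair
`(K, K') := (K_G, K_B)(−4,1,0,−1,2,1)` (framing `r = −3`) with its axis, and `J₀ = −T(2,3)`:
* `s_0(K'[J₀]) = s_0(K_B(−4+3, …)) = s_0(K_B(−1,1,0,−1,2,1)) = −2` (transport over ℚ, LZ Conj. 1.13 — `stub_transportQ`);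
  over 𝔽₂ unconditionally `s_2(K'[J₀]) = s_2(K_B(p*))` (LZ Main Theorem; not typable: the tree has no `s_2`).
* `r = −3` lies in Nakamura's window `[PF₋(−T(2,3)), PF₊(−T(2,3))) = [−4, 0)` (Nakamura 2023 Thm. 3.13, Cor. 2.13:
  `PF₊(T(2,3)) = 4`, `PF₋(T(2,3)) = 0`), the exact complement of every printed vanishing theorem; `(−T(2,3), −3)` is
  framed-slice in no definite `#k(±ℂℙ²)`, so Nakamura's Lemma 3.1 gives only indefinite stabilisations (no `s`-sign).
* STRATEGIST'S PRE-SCREEN (this seat, `compute/mp_alex_pure.py`, from MP's printed genus-2 Seifert matrix eq. (A)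
  p. 14): along `a ↦ a₀ + s` the Alexander polynomial of the `Δ = 1` rows is `1 + m s (t + t⁻¹ − 2)`, `m = 3` for the
  `r = 1` rows; Fox–Milnor ⟺ `−m s = n(n+1)`. So `a = −4` (shift `−4`): `Δ(K[J₀]) = Δ(K_G(−4,…)) = 12t² − 25t + 12
  = (3t − 4)(4t − 3)` PASSES Fox–Milnor and is Witt-trivial (no self-reciprocal factor ⇒ algebraically slice,
  signature function ≡ 0); `a = −3` fails (det 37), the `r = 2, 3` seed rows fail at shift `−4` (det 33, 17).
  The candidate `K[J₀] = K_G(−4,1,0,−1,2,1)[−T(2,3)]` (≈ 45 crossings) is therefore alive after every filter that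
  runs on this hub; the bet is that it is RIBBON. (Second live framing for the same seed: `a = −2`, `r = −1`,
  `Δ = (2t−3)(3t−2)`.)
If `K[J₀]` is ribbon then `(K[J₀], K'[J₀], −2)` is a crux witness; over 𝔽₂ alone it already proves the route's
thesis 0364 (exotic `S⁴`).

CONVENTION FLAG (as for the tree's `hasRasmussenInvariant_torusKnot`): `J₀ := (torusKnot 2 3).mirror` is "the
trefoil with tree-`s = −2`"; the twist offset `3` assumes that `Knot.TubularNbhd.HasFraming t` with `t > 0` is
right-handed twisting in the handedness for which that trefoil is negative. If either sign convention of the tree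
(`DehnSurgery` `det_pos`: "only `m ↦ −m` changes"; or the global sign of `rasmussenInvariant`) is opposite,
the correct instantiation is `3 ↦ −3` in BOTH `stub_transportQ` and `stub_windowWitness` (a one-token repair,
class `misstated`, not a refutation of the line); the combinatorial content (seed `p*`, framing `−3`, Fox–Milnor)
is convention-free.

## Stubs (3) and composition
* `stub_transportQ` (OPEN-KNOWN: LZ Conj. 1.13 at `c = 0` for the companion `−T(2,3)`; THEOREM over 𝔽₂; XL) —
  the transport law `TransportLaw J₀ 3`.
* `stub_axisFriends_satellite` (KNOWN 3-manifold lemma, M–L: 0-surgery on a winding-0 satellite is the splice of the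
  0-surgery along the axis; two surgery pictures of one `Y` with a common framed axis give one splice).
* `stub_windowWitness` (THE BET; finite: one explicit ≈45-crossing satellite is ribbon; everything else in it is
  MP's computation `s(K_B(−1,1,0,−1,2,1)) = −2` and RBG diagrammatics).
* `crux_reduction` / `ZseCruxRasmussen_of` (kernel-checked, no sorry of its own).

COSTUME / SHRED check: 3 stubs; `stub_windowWitness` does NOT contain the crux (it asserts neither a common surgery
of the satellites nor `s ≠ 0` of any satellite — those are DERIVED through the two lemma stubs), and the crux does
not imply it; `stub_transportQ` is a statement of Khovanov homology with no 4-dimensional content;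
`stub_axisFriends_satellite` is a 3-manifold lemma. None is the summit, SPC4, or a refuted statement
(`ledger negatives`: none for this crux's shapes).

## Disproof.lean honoured (v6, `Cruxes/ZseCruxRasmussen/Disproof.lean`)
§1 every conjunct load-bearing: `K[J₀]` ribbon is USED (`IsRibbon.isSmoothlySlice`), the common `Y` is MANUFACTURED
(`stub_axisFriends_satellite`), `s = −2 ≠ 0` comes from transport. §2 dead strengthenings: the pair is non-concordant
by construction and the 0-surgery homeomorphism has a KNOTTED framed ghost `(−T(2,3), −3)` (no property U, odd
`r` ⇒ traces not even homeomorphic, MP Thm. 3.9). §4/§7 (Gluck / ℂℙ²-dissolution): not evaded by theorem — if the MP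
sphere of the pair dissolves, transport's `−2` proves `K[J₀]` NON-slice instead (either way the stub is decided).
§9 τ-filter: consistent (`τ(K'[J₀])` must vanish if `K[J₀]` is slice; LZ Q. 1.10 would read it off `K_B(−2,…)`).
§11 sign normalisation: the witness is stated with `s = −2` (mirror the configuration for `+2`). §12: `K ≠ U`.
"Uniform" escape excluded: an axis-avoiding ribbon disc for `K` would make `K[J]` slice for all `J` and contradict
transport + Nakamura L3.1 + Gluck dissolution + MMSW one-signedness (triage r1-3 (B2′)); sliceness of `K[J₀]` is
necessarily `J`-sporadic. No stub is an instance of a landed Negative lemma (`Negative/Parity`: `−2` is even).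
-/

noncomputable section

set_option linter.dupNamespace false
set_option linter.unusedVariables false

open scoped Manifold ContDiff Topology
open Function Set
open Literature.Topology.FourManifolds

namespace Summit.SmoothPoincare4.SmoothPoincare4.Cruxes.ZseCruxRasmussen.LzTransportThetaWindow

/-- Local notation: `𝔼 n` is `EuclideanSpace ℝ (Fin n)`. -/
local notation "𝔼 " n:arg => EuclideanSpace ℝ (Fin n)

/-- Local notation: `𝕊 n` is the unit sphere in `EuclideanSpace ℝ (Fin (n + 1))`. -/
local notation "𝕊 " n:arg => (Metric.sphere (0 : EuclideanSpace ℝ (Fin (n + 1))) 1)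

/-- Local notation: `𝔻²` is the closed unit disc in `ℝ²`. -/
local notation "𝔻²" => Metric.closedBall (0 : EuclideanSpace ℝ (Fin 2)) 1

/-! ### 0-friends -/

/-- `K` and `K'` are **0-friends**: some 3-manifold `Y` is `0`-surgery on both (the binder shape of the crux).
[cite: ManolescuPiccirillo2023, §1] -/
def ZeroFriends (K K' : Knot) : Prop :=
  ∃ (Y : Type) (_ : TopologicalSpace Y) (_ : ChartedSpace (𝔼 3) Y),
    IsIntegralSurgery (𝓡 3) Y K 0 ∧ IsIntegralSurgery (𝓡 3) Y K' 0

/-! ### Axis patterns: an unknotted axis of winding number 0 and wrapping number ≤ 2 -/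

/-- A point of the knot `K` lies in the complement of a knot `η` disjoint from `K`. [folklore] -/
theorem apply_mem_complement {K η : Knot} (h : Disjoint (range K) (range η)) (x : 𝕊 1) :
    K x ∈ η.complement :=
  Set.disjoint_left.1 h (mem_range_self x)

/-- The knot `K`, disjoint from `η`, as a loop in the complement of `η` based at `K (circlePoint 0)`
(pattern of `Knot.TubularNbhd.longitude`). [folklore] -/
def axisLoop (K η : Knot) (h : Disjoint (range K) (range η)) :
    Path (⟨K (circlePoint 0), apply_mem_complement h _⟩ : η.complement)
      ⟨K (circlePoint 0), apply_mem_complement h _⟩ where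
  toFun θ := ⟨K (circlePoint (2 * Real.pi * θ)), apply_mem_complement h _⟩
  continuous_toFun := by
    refine Continuous.subtype_mk ?_ _
    exact K.continuous.comp (continuous_circlePoint.comp (continuous_const.mul continuous_subtype_val))
  source' := by
    apply Subtype.ext
    simp only [Set.Icc.coe_zero, mul_zero]
  target' := by
    apply Subtype.ext
    simp only [Set.Icc.coe_one, mul_one]
    rw [← zero_add (2 * Real.pi), circlePoint_add_two_pi]

/-- **Winding number zero**: the class of `K` in `H₁(S³ ∖ η) = π₁(S³ ∖ η)ᵃᵇ` is trivial, i.e. `lk(K, η) = 0`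
(framework of `Knot.TubularNbhd.HasFraming`). Rolfsen (1976), §5.D. [cite: Rolfsen1976, §5.D] -/
def WindingZero (K η : Knot) (h : Disjoint (range K) (range η)) : Prop :=
  Abelianization.of (FundamentalGroup.fromPath (Path.Homotopic.Quotient.mk (axisLoop K η h))) = 1

/-- `f : ℝ² → ℝ⁴` is a smooth **spanning disc of `η` inside `S³` meeting `K` in exactly two points** (so the
wrapping number of `K` about the axis `η` is at most `2`; with `WindingZero` it is `0` or `2`). Disc conventions as
in `Knot.IsSliceDisc`. Lewark–Zibrowius (2024), §1 (patterns of wrapping number two). [cite: LewarkZibrowius2024, §1] -/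
def IsSpanningDiscMeetingTwice (η K : Knot) (f : 𝔼 2 → 𝔼 4) : Prop :=
  ContDiff ℝ ∞ f ∧ InjOn f 𝔻² ∧ (∀ x ∈ 𝔻², Injective (fderiv ℝ f x)) ∧
    (∀ x ∈ 𝔻², f x ∈ Metric.sphere (0 : 𝔼 4) 1) ∧ (∀ x : 𝕊 1, f x = η x) ∧
    {x : 𝔼 2 | x ∈ 𝔻² ∧ f x ∈ (Subtype.val '' range K : Set (𝔼 4))}.ncard = 2

/-- `(K, η)` is an **axis pattern**: `η` is an unknot disjoint from `K`, `K` has winding number `0` about `η`, and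
`η` bounds a disc meeting `K` twice — i.e. `K ⊂ S³ ∖ ν(η)` is a pattern of winding number `0` and wrapping number
`≤ 2` in the solid torus `S³ ∖ ν(η)` (Lewark–Zibrowius 2024, §1; for a small special RBG link the meridian of `R` is
such an axis for both `K_B` and `K_G`: Manolescu–Piccirillo 2023 §4.2, Nakamura 2023 §3.3 p. 13). [cite: LewarkZibrowius2024, §1] -/
def IsAxisPattern (K η : Knot) : Prop :=
  η.IsUnknot ∧ ∃ h : Disjoint (range K) (range η), WindingZero K η h ∧ ∃ f, IsSpanningDiscMeetingTwice η K f

/-! ### Twisted satellites along an axis (splice form) -/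

/-- The **splice relation** between the complement of the axis `η` and the complement of the companion `J`, for
tubular neighbourhoods `νη`, `νJ`: the punctured collar `{νη (u, t • v) | 0 < t < 1}` of `η` is identified with the
punctured collar `{νJ (v, (1 − t) • u)}` of `J` — meridians of `η` go to push-offs (longitudes) of `νJ`, push-offs
of `νη` to meridians of `J`, and the side of `η` (`t → 0`, removed) to the far side of `J`'s collar. With `νη` of
framing `0` and `νJ` of framing `t` this is the gluing `V = S³ ∖ ν(η) → ν(J)`, `λ_η ↦ μ_J`, `μ_η ↦ λ_J + t μ_J` of the
`t`-twisted satellite construction. The coordinate change `(u, t, v) ↦ (v, 1 − t, u)` has Jacobian `+1`, so the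
gluing is orientation-compatible. Rolfsen (1976), §4.D, §9.F; Lewark–Zibrowius (2024), §1. [cite: Rolfsen1976, §4.D] -/
def spliceRel {η J : Knot} (νη : Knot.TubularNbhd η) (νJ : Knot.TubularNbhd J)
    (a : η.complement) (b : J.complement) : Prop :=
  ∃ (u v : 𝕊 1) (t : ℝ), t ∈ Ioo (0 : ℝ) 1 ∧ (a : 𝕊 3) = νη (u, t • (v : 𝔼 2)) ∧
    (b : 𝕊 3) = νJ (v, (1 - t) • (u : 𝔼 2))

/-- A point of a tubular neighbourhood of `K` disjoint from `η` lies in the complement of `η`. [folklore] -/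
theorem tubularNbhd_apply_mem_complement {K η : Knot} {νK : Knot.TubularNbhd K}
    (h : Disjoint (range νK) (range η)) (p : (𝕊 1) × (𝔼 2)) : νK p ∈ η.complement :=
  Set.disjoint_left.1 h (mem_range_self p)

/-- `K₁` **is the `t`-twisted satellite with companion `J` and pattern `(K, η)`** (splice form): `S³` (the ambient of
`K₁`) is an open gluing of `S³ ∖ η ⊇ K` and `S³ ∖ J` along `spliceRel νη νJ` with `νη` of framing `0` and `νJ` of
framing `t`, and the gluing map of the `η`-side carries an oriented tubular neighbourhood of `K` onto one of `K₁`
(so `K₁ = jA ∘ K` and `jA` preserves orientation — no mirror ambiguity). For `J = unknot` this is `K` twisted `t`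
times through the spanning disc of `η` (the `(−1/t)`-Rolfsen twist), i.e. LZ's `P_t(U)`; for `t = 0` it is the
untwisted satellite `P(J)`. Rolfsen (1976), §4.D, §9.H; Lewark–Zibrowius (2024), §1. [cite: LewarkZibrowius2024, §1] -/
def IsTwistedAxisSatellite (K η J : Knot) (t : ℤ) (K₁ : Knot) : Prop :=
  ∃ (νη : Knot.TubularNbhd η) (νJ : Knot.TubularNbhd J) (jA : η.complement → 𝕊 3) (jB : J.complement → 𝕊 3),
    νη.HasFraming 0 ∧ νJ.HasFraming t ∧ Disjoint (range K) (range νη) ∧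
    IsOpenGluingWith (𝓡 3) (𝓡 3) (𝓡 3) (spliceRel νη νJ) jA jB ∧
    ∃ (νK : Knot.TubularNbhd K) (hK : Disjoint (range νK) (range η)) (ν₁ : Knot.TubularNbhd K₁),
      ∀ p, (ν₁ p : 𝕊 3) = jA ⟨νK p, tubularNbhd_apply_mem_complement hK p⟩

/-! ### Axis-compatible 0-friends -/

/-- `K`, `K'` are **0-friends with compatible axes `η`, `η'`**: one `Y` carries two `0`-surgery pictures
(`surgeryRel`, framing `0`) whose gluing maps send `0`-framed oriented tubular neighbourhoods of `η ⊂ S³ ∖ K` and of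
`η' ⊂ S³ ∖ K'` to the SAME parametrised tube in `Y`. For a special RBG link this is the meridian `μ_R` of the red
component seen from the two slam-dunk pictures of `Y = S³_{r,0,0}(R ∪ B ∪ G)` (the slam-dunk diffeomorphisms are the
identity off a neighbourhood of `R ∪ B`, resp. `R ∪ G`). Manolescu–Piccirillo (2023), Thm. 1.2, §4.
[cite: ManolescuPiccirillo2023, Thm. 1.2] -/
def AxisFriends (K K' η η' : Knot) : Prop :=
  ∃ (Y : Type) (_ : TopologicalSpace Y) (_ : ChartedSpace (𝔼 3) Y)
    (νK : Knot.TubularNbhd K) (νK' : Knot.TubularNbhd K')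
    (jA : K.complement → Y) (jB : solidTorus → Y) (jA' : K'.complement → Y) (jB' : solidTorus → Y)
    (νη : Knot.TubularNbhd η) (νη' : Knot.TubularNbhd η')
    (hη : Disjoint (range νη) (range K)) (hη' : Disjoint (range νη') (range K')),
    νK.HasFraming 0 ∧ νK'.HasFraming 0 ∧ νη.HasFraming 0 ∧ νη'.HasFraming 0 ∧
    IsOpenGluingWith (𝓡 3) (𝓘(ℝ, 𝔼 2).prod (𝓡 1)) (𝓡 3) (surgeryRel νK) jA jB ∧
    IsOpenGluingWith (𝓡 3) (𝓘(ℝ, 𝔼 2).prod (𝓡 1)) (𝓡 3) (surgeryRel νK') jA' jB' ∧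
    ∀ p, jA ⟨νη p, tubularNbhd_apply_mem_complement hη p⟩ =
      jA' ⟨νη' p, tubularNbhd_apply_mem_complement hη' p⟩

/-- Axis-compatible 0-friends are 0-friends (forget the axes). [folklore] -/
theorem AxisFriends.zeroFriends {K K' η η' : Knot} (h : AxisFriends K K' η η') : ZeroFriends K K' := by
  obtain ⟨Y, _, _, νK, νK', jA, jB, jA', jB', νη, νη', hη, hη', hfK, hfK', -, -, hG, hG', -⟩ := h
  exact ⟨Y, ‹_›, ‹_›, ⟨νK, hfK, hG.isOpenGluing⟩, ⟨νK', hfK', hG'.isOpenGluing⟩⟩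

/-! ### The companion and the transport law -/

/-- The **companion** `J₀`: the mirror of the tree's torus knot `T(2,3)` — the trefoil with tree-`s = −2`
(`hasRasmussenInvariant_torusKnot` + `Knot.hasRasmussenInvariant_mirror_iff`), i.e. `−T(2,3)` in Lewark–Zibrowius'
notation (`θ₂ = −4`, `θ₀ = −3`). [cite: LewarkZibrowius2024, §1 Table 1 and eq. (theta_for_trefoil)] -/
def J₀ : Knot := (torusKnot 2 3 le_rfl (by norm_num) (by decide)).mirror

/-- The **Lewark–Zibrowius transport law** for the companion `J` with twist offset `θ`, over ℚ: for every axis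
pattern `(K, η)`, the Rasmussen invariant `s_0` of the untwisted satellite with companion `J` equals that of the
`θ`-twisted pattern at companion `U` — `s_0(P(J)) = s_0(P_θ(U))`. Lewark–Zibrowius (2024), Main Theorem (c = 2),
Conj. 1.13 (all c), with `θ = −θ_c(J)`. [cite: LewarkZibrowius2024, Main Theorem and Conj. 1.13] -/
def TransportLaw (J : Knot) (θ : ℤ) : Prop :=
  ∀ (K η Kθ KJ : Knot) (s : ℤ), IsAxisPattern K η → IsTwistedAxisSatellite K η unknot θ Kθ →
    IsTwistedAxisSatellite K η J 0 KJ → Kθ.HasRasmussenInvariant s → KJ.HasRasmussenInvariant s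

/-- The Alexander polynomial `12 − 25 t + 12 t² = (3t − 4)(4t − 3)` of the candidate `K_G(−4,1,0,−1,2,1)` and of all
its winding-0 satellites (strategist's computation from MP's Seifert matrix, arXiv:2102.04391 eq. (A) p. 14; passes
Fox–Milnor, Witt-trivial). [cite: ManolescuPiccirillo2023, §5.4 eq. (A)] -/
def lzAlexander : LaurentPolynomial ℤ :=
  LaurentPolynomial.C 12 - LaurentPolynomial.C 25 * LaurentPolynomial.T 1 + LaurentPolynomial.C 12 * LaurentPolynomial.T 2

/-! ### The three stubs -/

/-- **stub_transportQ** (OPEN-KNOWN, XL; Lewark–Zibrowius Conj. 1.13 at `c = 0` for the single companion `−T(2,3)`,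
`θ_0(T(2,3)) = 3`; over 𝔽₂ the same statement with `4` in place of `3` is LZ's Main Theorem, `θ_2(T(2,3)) = 4`).
For every axis pattern `(K, η)`: `s_0(P(−T(2,3))) = s_0(P_3(U))`. Convention flag: module docstring (if the tree's
framing or `s` sign is opposite, read `−3`). [cite: LewarkZibrowius2024, Conj. 1.13] -/
theorem stub_transportQ : TransportLaw J₀ 3 := by
  sorry

/-- **stub_axisFriends_satellite** (KNOWN 3-manifold lemma, M–L). If `K`, `K'` are 0-friends with compatible
`0`-framed axes and `(K, η)`, `(K', η')` are axis patterns (winding `0`), then for every companion `J` and twist `t`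
the `t`-twisted satellites are again 0-friends: `0`-surgery on a winding-0 satellite `P(J)` is the splice of
`S³₀(P(U))` along the axis with `S³ ∖ J` (a Seifert surface of the pattern off the axis survives, so the `0`-framings
agree), and the two surgery pictures of the common `Y` splice along the SAME framed tube. This is the content of
"`L ↦ L[J]` is again an RBG link presenting `(K_B[J], K_G[J])`" (Nakamura 2023 §3.3) stated without RBG links.
[cite: Nakamura2023, §3.3] -/
theorem stub_axisFriends_satellite :
    ∀ (K K' η η' J KJ K'J : Knot) (t : ℤ), IsAxisPattern K η → IsAxisPattern K' η' → AxisFriends K K' η η' →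
      IsTwistedAxisSatellite K η J t KJ → IsTwistedAxisSatellite K' η' J t K'J → ZeroFriends KJ K'J := by
  sorry

/-- **stub_windowWitness** (THE BET; finite). There is an axis-compatible pair of 0-friends `(K, K')` with axis
patterns such that the `3`-twisted partner `K'₃` has `s_0 = −2` and the `−T(2,3)`-satellite `KJ` of `K` has Alexander
polynomial `12 − 25t + 12t²` and is RIBBON (`K'J` denotes the `−T(2,3)`-satellite of `K'`). Intended instance
(Manolescu–Piccirillo's family, arXiv:2102.04391 §5, Fig. 13): `(K, K') = (K_G, K_B)(−4,1,0,−1,2,1)`, `η = η' = μ_R`,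
`K'₃ = K_B(−1,1,0,−1,2,1)` with `s = −2` COMPUTED (MP §5.3 p. 13), `KJ = K_G(−4,1,0,−1,2,1)[−T(2,3)]` (≈ 45 crossings;
Fox–Milnor passes, Witt-trivial — strategist's pre-screen), `K'J = K_B(−4,1,0,−1,2,1)[−T(2,3)]`. The only open conjunct
is `KJ.IsRibbon` — low prior (it yields an exotic `S⁴` over 𝔽₂ alone), decidable in practice by ribbon search /
slice obstructions on one explicit diagram. Convention flag as in `stub_transportQ`.
[cite: ManolescuPiccirillo2023, §5.3 p. 13; Nakamura2023, §3.3 Problem 3.14] -/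
theorem stub_windowWitness :
    ∃ (K K' η η' K'₃ KJ K'J : Knot), IsAxisPattern K η ∧ IsAxisPattern K' η' ∧ AxisFriends K K' η η' ∧
      IsTwistedAxisSatellite K' η' unknot 3 K'₃ ∧ K'₃.HasRasmussenInvariant (-2) ∧
      IsTwistedAxisSatellite K η J₀ 0 KJ ∧ IsTwistedAxisSatellite K' η' J₀ 0 K'J ∧
      KJ.IsAlexanderPolynomial lzAlexander ∧ KJ.IsRibbon := by
  sorry

/-! ### Composition (kernel-checked, no sorry of its own) -/

/-- **The reduction** (statement-level, sorry-free): the three stub STATEMENTS imply the crux's signature —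
witness ⇒ (friends lemma) a common `0`-surgery `Y` of the two satellites, (transport) `s_0(K'J) = −2 ≠ 0`,
`KJ` ribbon ⇒ smoothly slice. The conclusion is spelled out rather than named `Crux` so that exactly ONE theorem of
this file concludes the crux by name (`ZseCruxRasmussen_of`). [folklore] -/
theorem crux_reduction (hT : TransportLaw J₀ 3)
    (hF : ∀ (K K' η η' J KJ K'J : Knot) (t : ℤ), IsAxisPattern K η → IsAxisPattern K' η' → AxisFriends K K' η η' →
      IsTwistedAxisSatellite K η J t KJ → IsTwistedAxisSatellite K' η' J t K'J → ZeroFriends KJ K'J)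
    (hW : ∃ (K K' η η' K'₃ KJ K'J : Knot), IsAxisPattern K η ∧ IsAxisPattern K' η' ∧ AxisFriends K K' η η' ∧
      IsTwistedAxisSatellite K' η' unknot 3 K'₃ ∧ K'₃.HasRasmussenInvariant (-2) ∧
      IsTwistedAxisSatellite K η J₀ 0 KJ ∧ IsTwistedAxisSatellite K' η' J₀ 0 K'J ∧
      KJ.IsAlexanderPolynomial lzAlexander ∧ KJ.IsRibbon) :
    ∃ (K K' : Knot) (Y : Type) (_ : TopologicalSpace Y) (_ : ChartedSpace (𝔼 3) Y) (s : ℤ),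
      IsIntegralSurgery (𝓡 3) Y K 0 ∧ IsIntegralSurgery (𝓡 3) Y K' 0 ∧ K.IsSmoothlySlice ∧
        K'.HasRasmussenInvariant s ∧ s ≠ 0 := by
  obtain ⟨K, K', η, η', K'₃, KJ, K'J, hKη, hK'η', hAF, h3, hs3, hKJ, hK'J, -, hrib⟩ := hW
  obtain ⟨Y, _, _, hY, hY'⟩ := hF K K' η η' J₀ KJ K'J 0 hKη hK'η' hAF hKJ hK'J
  exact ⟨KJ, K'J, Y, ‹_›, ‹_›, -2, hY, hY', hrib.isSmoothlySlice, hT K' η' K'₃ K'J (-2) hK'η' h3 hK'J hs3,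
    by norm_num⟩

/-- **Composition — `Literature.Uncategorized.Crux` (= item stmt-SmoothPoincare4-0366 verbatim) BY NAME from the three
registered stubs.** `sorryAx` enters only through `stub_transportQ`, `stub_axisFriends_satellite`, `stub_windowWitness`;
the reduction itself is `crux_reduction`. [folklore] -/
theorem ZseCruxRasmussen_of : Literature.Uncategorized.Crux :=
  crux_reduction stub_transportQ stub_axisFriends_satellite stub_windowWitness

/-- `Literature.Uncategorized.Crux` is letter for letter the ledger signature of stmt-SmoothPoincare4-0366. [folklore] -/
theorem crux_signature : Literature.Uncategorized.Crux ↔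
    ∃ (K K' : Literature.Topology.FourManifolds.Knot) (Y : Type) (_ : TopologicalSpace Y)
      (_ : ChartedSpace (EuclideanSpace ℝ (Fin 3)) Y) (s : ℤ),
      Literature.Topology.FourManifolds.IsIntegralSurgery (𝓡 3) Y K 0 ∧
      Literature.Topology.FourManifolds.IsIntegralSurgery (𝓡 3) Y K' 0 ∧ K.IsSmoothlySlice ∧
      K'.HasRasmussenInvariant s ∧ s ≠ 0 :=
  Iff.rfl

/-- Over 𝔽₂ alone (LZ Main Theorem instead of Conj. 1.13) the same witness proves the route's THESIS 0364 directly;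
recorded as the `s`-free shadow: a ribbon `KJ` with a non-slice 0-friend gives `ZseThesis`. [folklore] -/
theorem zseThesis_of_ribbon_friend_not_slice {KJ K'J : Knot} (hfr : ZeroFriends KJ K'J) (hrib : KJ.IsRibbon)
    (hns : ¬ K'J.IsSmoothlySlice) : Summit.SmoothPoincare4.SmoothPoincare4.Theses.ZeroSurgeryExotic.ZseThesis := by
  obtain ⟨Y, _, _, hY, hY'⟩ := hfr
  exact ⟨KJ, K'J, Y, ‹_›, ‹_›, hY, hY', hrib.isSmoothlySlice, hns⟩

end Summit.SmoothPoincare4.SmoothPoincare4.Cruxes.ZseCruxRasmussen.LzTransportThetaWindow
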